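import Mathlib.MeasureTheory.Integral.IntervalIntegral.FundThmCalculus
import Literature.Analysis.FluidPDE.TorusTameCommutator
import Literature.Analysis.FluidPDE.EulerGalerkinLeibniz
import Summits.AnomalousDissipation.AnomalousDissipation.Theorems.MarginalStabilityChainChainRealisationStubUniformGronwall
import Summits.AnomalousDissipation.AnomalousDissipation.Theorems.MarginalStabilityChainChainRealisationStubPureBalance
import Summits.AnomalousDissipation.AnomalousDissipation.Theorems.MarginalStabilityChainChainRealisationStubSobolevBootstrapA
import HarnessLib

/-!
# Stub `stub_sobolevLadder` of the line `SketchIdeator2` (card `separatrix-flux-pinning`), helper file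
# (crux `MarginalStabilityChain.ChainRealisation`, stmt-AnomalousDissipation-14249)

Helper file (everything proved; theorems only) for the sorry-free discharge of the registered stub
`stub_sobolevLadder` (P3, the Sobolev ladder = all-orders absorbing bounds of a forward classical
Navier–Stokes orbit on `T³`) in `…StubSobolevLadder.lean`.  With the **pure energies**
`P_m(v) = Σᵢ ∫‖∂ᵢᵐ v‖²` and the **level energies** `y_m(v) = ∫‖v‖² + P_m(v)` of a smooth field
`v : T³ → ℝ³` it supplies:

* `ladder_latNormSq_le` — `latNormSq m v ≤ 4ᵐ y_m(v)` (`Torus.latNormSq_le_pure`, `wordDeriv_replicate`);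
* `ladder_rate_le` — the **static level inequality**: for `m ≥ 3` there is `K ≥ 0` with
  `2(−ν‖∇v‖₂² − ∫⟪(v·∇)v, v⟫ + ∫⟪F, v⟫) + 2Σᵢ(−ν‖∇∂ᵢᵐv‖₂² − ∫⟪∂ᵢᵐ[(v·∇)v], ∂ᵢᵐv⟫ + ∫⟪∂ᵢᵐF, ∂ᵢᵐv⟫)`
  `≤ −2ν P_{m+1}(v) + (K (1 + y₃(v)) + 1) y_m(v) + (∫‖F‖² + Σᵢ∫‖∂ᵢᵐF‖²)`
  for smooth solenoidal `v`, smooth `F` and `ν ≥ 0` (the tame commutator estimate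
  `Torus.exists_abs_integral_inner_iterate_convect_le`, `∫⟪(v·∇)v, v⟫ = 0`, Young in the form of the
  landed `sobolev_aux_integral_inner_le`, and `‖∇∂ᵢᵐv‖₂² ≥ ∫‖∂ᵢᵐ⁺¹v‖²`);
* `ladder_continuousOn_pure`, `ladder_continuousOn_lev` — time continuity of `P_m(u(t))`, `y_m(u(t))`
  for a jointly smooth `u` on `[0, ∞) × T³` (the landed `pureBalance_isSmoothSpaceTimeOn_iterate_partialDeriv`);
* `ladder_gronwall_step`, `ladder_window_step`, `ladder_window_add_le` — the real-analysis steps of the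
  ladder: the landed uniform Gronwall lemma `stub_uniformGronwall` read for `g = K(1 + G) + 1`, and the
  sliding-window dissipation bound obtained by integrating `Y' ≤ −2ν P + (K(1 + G) + 1) Y + H` over
  `[t, t + 1]` (`intervalIntegral.sub_le_integral_of_hasDeriv_right_of_le`).

References: C. Foias, O. Manley, R. Rosa, R. Temam, *Navier–Stokes Equations and Turbulence*, CUP 2001,
Ch. II App. A (A.61)–(A.66); P. Constantin, C. Foias, *Navier–Stokes Equations*, 1988, Ch. 13.
-/

set_option linter.dupNamespace false

noncomputable section

open MeasureTheory Set Filter Topology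
open scoped InnerProductSpace
open Literature.Analysis.FunctionSpaces Literature.Analysis.FunctionSpaces.Torus
open Literature.Analysis.FluidPDE Literature.Analysis.FluidPDE.Torus

namespace Summit.AnomalousDissipation.AnomalousDissipation.Theorems.ChainRealisation.SeparatrixFluxPinning

/-! ## Static inequalities on one time slice -/

/-- `latNormSq m v ≤ 4ᵐ (∫‖v‖² + Σᵢ ∫‖∂ᵢᵐ v‖²)` for smooth `v : T³ → ℝ³`
(`Torus.latNormSq_le_pure` with `#Fin 3 + 1 = 4` and `wordDeriv_replicate`). -/
theorem ladder_latNormSq_le {v : UnitAddTorus (Fin 3) → EuclideanSpace ℝ (Fin 3)} (hv : IsSmooth v)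
    (m : ℕ) :
    latNormSq m v ≤ 4 ^ m * ((∫ x, ‖v x‖ ^ 2) + ∑ i : Fin 3, ∫ x, ‖((partialDeriv i)^[m] v) x‖ ^ 2) := by
  have h := latNormSq_le_pure hv m
  simp only [wordDeriv_replicate, Fintype.card_fin, Nat.cast_ofNat] at h
  norm_num at h
  exact h

/-- One summand of the dissipation: `∫‖∂ᵢᵐ⁺¹ v‖² ≤ ‖∇∂ᵢᵐ v‖₂² = gradNormSq (∂ᵢᵐ v)`. -/
theorem ladder_integral_iterate_succ_le_gradNormSq {v : UnitAddTorus (Fin 3) → EuclideanSpace ℝ (Fin 3)}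
    (hv : IsSmooth v) (i : Fin 3) (m : ℕ) :
    ∫ x, ‖((partialDeriv i)^[m + 1] v) x‖ ^ 2 ≤ gradNormSq ((partialDeriv i)^[m] v) := by
  have hw : IsSmooth ((partialDeriv i)^[m] v) := isSmooth_iterate_partialDeriv hv i m
  rw [gradNormSq, Function.iterate_succ_apply']
  refine integral_mono (hw.partialDeriv i).norm_sq.integrable
    (integrable_finsetSum _ fun j _ => (hw.partialDeriv j).norm_sq.integrable) fun x => ?_
  exact Finset.single_le_sum (f := fun j => ‖partialDeriv j ((partialDeriv i)^[m] v) x‖ ^ 2)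
    (fun j _ => sq_nonneg _) (Finset.mem_univ i)

/-- The tame right-hand side on the diagonal: `tameRHS m v v ≤ 8 (1 + y₃(v)) · 4ᵐ y_m(v)`
(`tameRHS m v v = 2√(lat₃ v) latₘ v`, `lat₃ ≤ 64 y₃`, `√y₃ ≤ (1 + y₃)/2`, `latₘ ≤ 4ᵐ y_m`). -/
theorem ladder_tameRHS_self_le {v : UnitAddTorus (Fin 3) → EuclideanSpace ℝ (Fin 3)} (hv : IsSmooth v)
    (m : ℕ) :
    tameRHS m v v ≤ 8 * (1 + ((∫ x, ‖v x‖ ^ 2) + ∑ i : Fin 3, ∫ x, ‖((partialDeriv i)^[3] v) x‖ ^ 2)) *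
      (4 ^ m * ((∫ x, ‖v x‖ ^ 2) + ∑ i : Fin 3, ∫ x, ‖((partialDeriv i)^[m] v) x‖ ^ 2)) := by
  set y3 : ℝ := (∫ x, ‖v x‖ ^ 2) + ∑ i : Fin 3, ∫ x, ‖((partialDeriv i)^[3] v) x‖ ^ 2 with hy3
  set ym : ℝ := (∫ x, ‖v x‖ ^ 2) + ∑ i : Fin 3, ∫ x, ‖((partialDeriv i)^[m] v) x‖ ^ 2 with hym
  have hy30 : 0 ≤ y3 := add_nonneg (integral_nonneg fun _ => sq_nonneg _)
    (Finset.sum_nonneg fun _ _ => integral_nonneg fun _ => sq_nonneg _)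
  have hym0 : 0 ≤ ym := add_nonneg (integral_nonneg fun _ => sq_nonneg _)
    (Finset.sum_nonneg fun _ _ => integral_nonneg fun _ => sq_nonneg _)
  have h3 : latNormSq 3 v ≤ 64 * y3 := by
    have := ladder_latNormSq_le hv 3
    norm_num at this
    exact this
  have hm : latNormSq m v ≤ 4 ^ m * ym := ladder_latNormSq_le hv m
  have hl0 : 0 ≤ latNormSq m v := latNormSq_nonneg m v
  have hsq : Real.sqrt y3 ≤ (1 + y3) / 2 := by
    nlinarith [Real.sq_sqrt hy30, Real.sqrt_nonneg y3, sq_nonneg (Real.sqrt y3 - 1)]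
  have hs3 : Real.sqrt (latNormSq 3 v) ≤ 4 * (1 + y3) := by
    calc Real.sqrt (latNormSq 3 v) ≤ Real.sqrt (64 * y3) := Real.sqrt_le_sqrt h3
      _ = 8 * Real.sqrt y3 := by
          rw [Real.sqrt_mul (by norm_num), show (64 : ℝ) = 8 ^ 2 by norm_num,
            Real.sqrt_sq (by norm_num)]
      _ ≤ 8 * ((1 + y3) / 2) := mul_le_mul_of_nonneg_left hsq (by norm_num)
      _ = 4 * (1 + y3) := by ring
  have e : tameRHS m v v = 2 * (Real.sqrt (latNormSq 3 v) * latNormSq m v) := by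
    unfold tameRHS
    rw [mul_comm (Real.sqrt (latNormSq m v)) (Real.sqrt (latNormSq 3 v)), mul_assoc,
      Real.mul_self_sqrt hl0]
    ring
  rw [e]
  calc 2 * (Real.sqrt (latNormSq 3 v) * latNormSq m v) ≤ 2 * (4 * (1 + y3) * (4 ^ m * ym)) := by
        gcongr
    _ = 8 * (1 + y3) * (4 ^ m * ym) := by ring

/-- **The static level inequality.**  For `m ≥ 3` there is `K ≥ 0` such that for every `ν ≥ 0`,
every smooth divergence-free `v : T³ → ℝ³` and every smooth `F`, twice the sum of the right-hand
sides of the pure balances of orders `0` and `m` (all directions) is at most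
`−2ν P_{m+1}(v) + (K (1 + y₃(v)) + 1) y_m(v) + (∫‖F‖² + Σᵢ∫‖∂ᵢᵐF‖²)`:
the transport pairing `∫⟪(v·∇)v, v⟫` vanishes, the commutator pairings are bounded by the tame
estimate `Torus.exists_abs_integral_inner_iterate_convect_le` and `ladder_tameRHS_self_le`, the
force pairings by Young, and `‖∇∂ᵢᵐv‖₂² ≥ ∫‖∂ᵢᵐ⁺¹v‖²`. -/
theorem ladder_rate_le : ∀ {m : ℕ}, 3 ≤ m →
    ∃ K : ℝ, 0 ≤ K ∧ ∀ (ν : ℝ) (v F : UnitAddTorus (Fin 3) → EuclideanSpace ℝ (Fin 3)),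
      0 ≤ ν → IsSmooth v → IsSmooth F → IsDivFree v →
      2 * (-ν * gradNormSq v - (∫ x, ⟪convect v v x, v x⟫_ℝ) + ∫ x, ⟪F x, v x⟫_ℝ) +
        2 * ∑ i : Fin 3, (-ν * gradNormSq ((partialDeriv i)^[m] v) -
            (∫ x, ⟪((partialDeriv i)^[m] (convect v v)) x, ((partialDeriv i)^[m] v) x⟫_ℝ) +
          ∫ x, ⟪((partialDeriv i)^[m] F) x, ((partialDeriv i)^[m] v) x⟫_ℝ) ≤
      -(2 * ν) * (∑ i : Fin 3, ∫ x, ‖((partialDeriv i)^[m + 1] v) x‖ ^ 2) +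
        (K * (1 + ((∫ x, ‖v x‖ ^ 2) + ∑ i : Fin 3, ∫ x, ‖((partialDeriv i)^[3] v) x‖ ^ 2)) + 1) *
          ((∫ x, ‖v x‖ ^ 2) + ∑ i : Fin 3, ∫ x, ‖((partialDeriv i)^[m] v) x‖ ^ 2) +
        ((∫ x, ‖F x‖ ^ 2) + ∑ i : Fin 3, ∫ x, ‖((partialDeriv i)^[m] F) x‖ ^ 2) := by
  intro m hm
  obtain ⟨C, hC0, hC⟩ := exists_abs_integral_inner_iterate_convect_le (d := Fin 3) (by simp) hm
  refine ⟨48 * C * 4 ^ m, by positivity, fun ν v F hν hv hF hdiv => ?_⟩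
  set y3 : ℝ := (∫ x, ‖v x‖ ^ 2) + ∑ i : Fin 3, ∫ x, ‖((partialDeriv i)^[3] v) x‖ ^ 2 with hy3
  set ym : ℝ := (∫ x, ‖v x‖ ^ 2) + ∑ i : Fin 3, ∫ x, ‖((partialDeriv i)^[m] v) x‖ ^ 2 with hym
  have hy30 : 0 ≤ y3 := add_nonneg (integral_nonneg fun _ => sq_nonneg _)
    (Finset.sum_nonneg fun _ _ => integral_nonneg fun _ => sq_nonneg _)
  have hym0 : 0 ≤ ym := add_nonneg (integral_nonneg fun _ => sq_nonneg _)
    (Finset.sum_nonneg fun _ _ => integral_nonneg fun _ => sq_nonneg _)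
  -- order zero
  have h0c : ∫ x, ⟪convect v v x, v x⟫_ℝ = 0 := integral_inner_convect_self_eq_zero hv hdiv
  have h0g : 0 ≤ ν * gradNormSq v := mul_nonneg hν (gradNormSq_nonneg v)
  have h0f := sobolev_aux_integral_inner_le hF hv
  -- order `m`, direction `i`
  set B : ℝ := C * (8 * (1 + y3) * (4 ^ m * ym)) with hB
  have hterm : ∀ i : Fin 3,
      -ν * gradNormSq ((partialDeriv i)^[m] v) -
          (∫ x, ⟪((partialDeriv i)^[m] (convect v v)) x, ((partialDeriv i)^[m] v) x⟫_ℝ) +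
        ∫ x, ⟪((partialDeriv i)^[m] F) x, ((partialDeriv i)^[m] v) x⟫_ℝ ≤
      -ν * (∫ x, ‖((partialDeriv i)^[m + 1] v) x‖ ^ 2) + B +
        (2⁻¹ * (∫ x, ‖((partialDeriv i)^[m] F) x‖ ^ 2) +
          2⁻¹ * ∫ x, ‖((partialDeriv i)^[m] v) x‖ ^ 2) := by
    intro i
    have h1 : -ν * gradNormSq ((partialDeriv i)^[m] v) ≤
        -ν * ∫ x, ‖((partialDeriv i)^[m + 1] v) x‖ ^ 2 := by
      have := ladder_integral_iterate_succ_le_gradNormSq hv i m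
      nlinarith
    have h2 : -(∫ x, ⟪((partialDeriv i)^[m] (convect v v)) x, ((partialDeriv i)^[m] v) x⟫_ℝ) ≤ B :=
      calc -(∫ x, ⟪((partialDeriv i)^[m] (convect v v)) x, ((partialDeriv i)^[m] v) x⟫_ℝ)
          ≤ |∫ x, ⟪((partialDeriv i)^[m] (convect v v)) x, ((partialDeriv i)^[m] v) x⟫_ℝ| :=
            neg_le_abs _
        _ ≤ C * tameRHS m v v := hC v v hv hv i
        _ ≤ B := mul_le_mul_of_nonneg_left (ladder_tameRHS_self_le hv m) hC0
    have h3 := sobolev_aux_integral_inner_le (isSmooth_iterate_partialDeriv hF i m)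
      (isSmooth_iterate_partialDeriv hv i m)
    linarith
  have hsum : ∑ i : Fin 3, (-ν * gradNormSq ((partialDeriv i)^[m] v) -
          (∫ x, ⟪((partialDeriv i)^[m] (convect v v)) x, ((partialDeriv i)^[m] v) x⟫_ℝ) +
        ∫ x, ⟪((partialDeriv i)^[m] F) x, ((partialDeriv i)^[m] v) x⟫_ℝ) ≤
      -ν * (∑ i : Fin 3, ∫ x, ‖((partialDeriv i)^[m + 1] v) x‖ ^ 2) + 3 * B +
        (2⁻¹ * (∑ i : Fin 3, ∫ x, ‖((partialDeriv i)^[m] F) x‖ ^ 2) +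
          2⁻¹ * ∑ i : Fin 3, ∫ x, ‖((partialDeriv i)^[m] v) x‖ ^ 2) := by
    refine (Finset.sum_le_sum fun i _ => hterm i).trans (le_of_eq ?_)
    simp only [Finset.sum_add_distrib, Finset.sum_const, Finset.card_univ, Fintype.card_fin,
      ← Finset.mul_sum, nsmul_eq_mul, Nat.cast_ofNat]
  have hBK : 2 * (3 * B) = 48 * C * 4 ^ m * (1 + y3) * ym := by rw [hB]; ring
  nlinarith [hsum, h0f, h0g, h0c, hBK, hterm 0]

/-! ## Time continuity of the energies of a jointly smooth field -/

/-- Time continuity of the pure energies `P_m(u(s)) = Σᵢ ∫‖∂ᵢᵐu(s)‖²` on `[0, ∞)` for a jointly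
smooth `u` (space integrals of jointly smooth integrands, `IsSmoothSpaceTimeOn.continuousOn_integral`). -/
theorem ladder_continuousOn_pure {u : ℝ → UnitAddTorus (Fin 3) → EuclideanSpace ℝ (Fin 3)}
    (hu : IsSmoothSpaceTimeOn (Ici (0 : ℝ)) u) (m : ℕ) :
    ContinuousOn (fun s => ∑ i : Fin 3, ∫ x, ‖((partialDeriv i)^[m] (u s)) x‖ ^ 2) (Ici (0 : ℝ)) := by
  have h1 : ∀ i : Fin 3, IsSmoothSpaceTimeOn (Ici (0 : ℝ))
      (fun s x => ‖((partialDeriv i)^[m] (u s)) x‖ ^ 2) := fun i : Fin 3 =>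
    ContDiffOn.norm_sq ℝ (pureBalance_isSmoothSpaceTimeOn_iterate_partialDeriv hu (uniqueDiffOn_Ici 0) i m)
  exact continuousOn_finsetSum _ fun i _ => (h1 i).continuousOn_integral (convex_Ici 0)

/-- Time continuity of `s ↦ ∫‖u(s)‖²` on `[0, ∞)` for a jointly smooth `u`. -/
theorem ladder_continuousOn_l2 {u : ℝ → UnitAddTorus (Fin 3) → EuclideanSpace ℝ (Fin 3)}
    (hu : IsSmoothSpaceTimeOn (Ici (0 : ℝ)) u) :
    ContinuousOn (fun s => ∫ x, ‖u s x‖ ^ 2) (Ici (0 : ℝ)) := by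
  have h1 : IsSmoothSpaceTimeOn (Ici (0 : ℝ)) (fun s x => ‖u s x‖ ^ 2) := ContDiffOn.norm_sq ℝ hu
  exact h1.continuousOn_integral (convex_Ici 0)

/-- Time continuity of the level energies `y_m(u(s)) = ∫‖u(s)‖² + P_m(u(s))` on `[0, ∞)`. -/
theorem ladder_continuousOn_lev {u : ℝ → UnitAddTorus (Fin 3) → EuclideanSpace ℝ (Fin 3)}
    (hu : IsSmoothSpaceTimeOn (Ici (0 : ℝ)) u) (m : ℕ) :
    ContinuousOn (fun s => (∫ x, ‖u s x‖ ^ 2) + ∑ i : Fin 3, ∫ x, ‖((partialDeriv i)^[m] (u s)) x‖ ^ 2)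
      (Ici (0 : ℝ)) :=
  (ladder_continuousOn_l2 hu).add (ladder_continuousOn_pure hu m)

/-! ## Real analysis: the two steps of the ladder -/

/-- Window integrals of the affine weight: `∫ₜ^{t+1} (K(1 + G) + 1) = K (1 + ∫ₜ^{t+1} G) + 1`. -/
theorem ladder_integral_weight {G : ℝ → ℝ} {t₀ K t : ℝ} (hGc : ContinuousOn G (Ici t₀)) (ht : t₀ ≤ t) :
    ∫ s in t..t + 1, (K * (1 + G s) + 1) = K * (1 + ∫ s in t..t + 1, G s) + 1 := by
  have ht1 : t ≤ t + 1 := (lt_add_one t).le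
  have hGi : IntervalIntegrable G volume t (t + 1) := uniformGronwall_intervalIntegrable hGc ht ht1
  have e : (fun s => K * (1 + G s) + 1) = fun s => K * G s + (K + 1) := by
    funext s; ring
  rw [e, intervalIntegral.integral_add (hGi.const_mul K) intervalIntegrable_const,
    intervalIntegral.integral_const_mul, intervalIntegral.integral_const, add_sub_cancel_left, one_smul]
  ring

/-- **Gronwall step of the ladder** (the landed uniform Gronwall lemma `stub_uniformGronwall` with
`r = 1`, `g = K(1 + G) + 1`, `h = H`): if `Y' ≤ −2ν P + (K(1 + G) + 1) Y + H` from the right on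
`[t₀, ∞)` with `Y, G, P ≥ 0` continuous, `K, H, ν ≥ 0`, `∫ₜ^{t+1} G ≤ A₃` and `∫ₜ^{t+1} Y ≤ A` for
`t ≥ t₀`, then `Y(t) ≤ (A + H) e^{K(1 + A₃) + 1}` for all `t ≥ t₀ + 1`. -/
theorem ladder_gronwall_step {Y Y' G P : ℝ → ℝ} {t₀ ν K H A₃ A : ℝ}
    (hYc : ContinuousOn Y (Ici t₀)) (hGc : ContinuousOn G (Ici t₀))
    (hYd : ∀ s : ℝ, t₀ ≤ s → HasDerivWithinAt Y (Y' s) (Ici s) s)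
    (hineq : ∀ s : ℝ, t₀ ≤ s → Y' s ≤ -(2 * ν) * P s + (K * (1 + G s) + 1) * Y s + H)
    (hY0 : ∀ s : ℝ, t₀ ≤ s → 0 ≤ Y s) (hG0 : ∀ s : ℝ, t₀ ≤ s → 0 ≤ G s)
    (hP0 : ∀ s : ℝ, t₀ ≤ s → 0 ≤ P s) (hν : 0 ≤ ν) (hK : 0 ≤ K) (hH : 0 ≤ H)
    (hIG : ∀ t : ℝ, t₀ ≤ t → ∫ s in t..t + 1, G s ≤ A₃)
    (hIY : ∀ t : ℝ, t₀ ≤ t → ∫ s in t..t + 1, Y s ≤ A) :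
    ∀ t : ℝ, t₀ + 1 ≤ t → Y t ≤ (A + H) * Real.exp (K * (1 + A₃) + 1) := by
  intro t ht
  have hgc : ContinuousOn (fun s => K * (1 + G s) + 1) (Ici t₀) :=
    (continuousOn_const.mul (continuousOn_const.add hGc)).add continuousOn_const
  have hineq' : ∀ s : ℝ, t₀ ≤ s → Y' s ≤ (K * (1 + G s) + 1) * Y s + H := by
    intro s hs
    have := hineq s hs
    have : 0 ≤ 2 * ν * P s := mul_nonneg (mul_nonneg (by norm_num) hν) (hP0 s hs)
    linarith
  have hg0 : ∀ s : ℝ, t₀ ≤ s → 0 ≤ K * (1 + G s) + 1 := fun s hs => by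
    have := hG0 s hs; positivity
  have hIg : ∀ t : ℝ, t₀ ≤ t → ∫ s in t..t + 1, (K * (1 + G s) + 1) ≤ K * (1 + A₃) + 1 := by
    intro t ht
    rw [ladder_integral_weight hGc ht]
    have := hIG t ht
    nlinarith
  have hIh : ∀ t : ℝ, t₀ ≤ t → ∫ _ in t..t + 1, H ≤ H := fun t _ => by
    rw [intervalIntegral.integral_const, add_sub_cancel_left, one_smul]
  have key := stub_uniformGronwall Y Y' (fun s => K * (1 + G s) + 1) (fun _ => H) t₀ 1
    (K * (1 + A₃) + 1) H A one_pos hYc hgc continuousOn_const hYd hineq' hY0 hg0 (fun _ _ => hH)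
    hIg hIh hIY (t - 1) (by linarith)
  rw [sub_add_cancel, div_one] at key
  exact key

/-- **Window step of the ladder**: if `Y' ≤ −2ν P + (K(1 + G) + 1) Y + H` from the right on
`[t₀, ∞)` with `Y, G, P` continuous, `0 ≤ Y ≤ B`, `G ≥ 0`, `K ≥ 0`, `ν > 0` and `∫ₜ^{t+1} G ≤ A₃`
for `t ≥ t₀`, then `∫ₜ^{t+1} P ≤ (B + (K(1 + A₃) + 1) B + H)/(2ν)` for all `t ≥ t₀`
(integrate the differential inequality over `[t, t+1]`:
`intervalIntegral.sub_le_integral_of_hasDeriv_right_of_le`). -/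
theorem ladder_window_step {Y Y' G P : ℝ → ℝ} {t₀ ν K H A₃ B : ℝ} (hν : 0 < ν)
    (hYc : ContinuousOn Y (Ici t₀)) (hGc : ContinuousOn G (Ici t₀)) (hPc : ContinuousOn P (Ici t₀))
    (hYd : ∀ s : ℝ, t₀ ≤ s → HasDerivWithinAt Y (Y' s) (Ici s) s)
    (hineq : ∀ s : ℝ, t₀ ≤ s → Y' s ≤ -(2 * ν) * P s + (K * (1 + G s) + 1) * Y s + H)
    (hY0 : ∀ s : ℝ, t₀ ≤ s → 0 ≤ Y s) (hYB : ∀ s : ℝ, t₀ ≤ s → Y s ≤ B)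
    (hG0 : ∀ s : ℝ, t₀ ≤ s → 0 ≤ G s) (hK : 0 ≤ K)
    (hIG : ∀ t : ℝ, t₀ ≤ t → ∫ s in t..t + 1, G s ≤ A₃) :
    ∀ t : ℝ, t₀ ≤ t → ∫ s in t..t + 1, P s ≤ (B + (K * (1 + A₃) + 1) * B + H) / (2 * ν) := by
  intro t ht
  have ht1 : t ≤ t + 1 := (lt_add_one t).le
  have hsub : Icc t (t + 1) ⊆ Ici t₀ := fun s hs => ht.trans hs.1
  have hB0 : 0 ≤ B := (hY0 t ht).trans (hYB t ht)
  set φ : ℝ → ℝ := fun s => -(2 * ν) * P s + (K * B * G s + ((K + 1) * B + H)) with hφ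
  have hφc : ContinuousOn φ (Ici t₀) :=
    (continuousOn_const.mul hPc).add ((continuousOn_const.mul hGc).add continuousOn_const)
  have hle : ∀ s ∈ Ioo t (t + 1), Y' s ≤ φ s := by
    intro s hs
    have hs₀ : t₀ ≤ s := ht.trans hs.1.le
    have h1 := hineq s hs₀
    have h2 : (K * (1 + G s) + 1) * Y s ≤ (K * (1 + G s) + 1) * B :=
      mul_le_mul_of_nonneg_left (hYB s hs₀) (by have := hG0 s hs₀; positivity)
    have h3 : (K * (1 + G s) + 1) * B = K * B * G s + (K + 1) * B := by ring
    simp only [hφ]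
    linarith
  have hFTC : Y (t + 1) - Y t ≤ ∫ s in t..t + 1, φ s :=
    intervalIntegral.sub_le_integral_of_hasDeriv_right_of_le ht1 (hYc.mono hsub)
      (fun s hs => (hYd s (ht.trans hs.1.le)).Ioi_of_Ici) ((hφc.mono hsub).integrableOn_Icc) hle
  have hPi : IntervalIntegrable P volume t (t + 1) := uniformGronwall_intervalIntegrable hPc ht ht1
  have hGi : IntervalIntegrable G volume t (t + 1) := uniformGronwall_intervalIntegrable hGc ht ht1
  have hIφ : ∫ s in t..t + 1, φ s =
      -(2 * ν) * (∫ s in t..t + 1, P s) + (K * B * (∫ s in t..t + 1, G s) + ((K + 1) * B + H)) := by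
    simp only [hφ]
    rw [intervalIntegral.integral_add (hPi.const_mul _) ((hGi.const_mul _).add intervalIntegrable_const),
      intervalIntegral.integral_const_mul,
      intervalIntegral.integral_add (hGi.const_mul _) intervalIntegrable_const,
      intervalIntegral.integral_const_mul, intervalIntegral.integral_const, add_sub_cancel_left, one_smul]
  rw [hIφ] at hFTC
  have hKG : K * B * (∫ s in t..t + 1, G s) ≤ K * B * A₃ :=
    mul_le_mul_of_nonneg_left (hIG t ht) (mul_nonneg hK hB0)
  have hY1 := hY0 (t + 1) (ht.trans ht1)
  have hYt := hYB t ht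
  rw [le_div_iff₀ (by positivity)]
  nlinarith

/-- Window integrals of a sum with a bounded first summand:
`∫ₜ^{t+1} (E + P) ≤ M + ∫ₜ^{t+1} P` if `E ≤ M` on `[t₀, ∞)`, `t ≥ t₀` (continuity for integrability). -/
theorem ladder_window_add_le {E P : ℝ → ℝ} {t₀ M t : ℝ} (hEc : ContinuousOn E (Ici t₀))
    (hPc : ContinuousOn P (Ici t₀)) (hE : ∀ s : ℝ, t₀ ≤ s → E s ≤ M) (ht : t₀ ≤ t) :
    ∫ s in t..t + 1, (E s + P s) ≤ M + ∫ s in t..t + 1, P s := by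
  have ht1 : t ≤ t + 1 := (lt_add_one t).le
  have hEi : IntervalIntegrable E volume t (t + 1) := uniformGronwall_intervalIntegrable hEc ht ht1
  have hPi : IntervalIntegrable P volume t (t + 1) := uniformGronwall_intervalIntegrable hPc ht ht1
  rw [intervalIntegral.integral_add hEi hPi]
  have hmono := intervalIntegral.integral_mono_on (g := fun _ => M) ht1 hEi intervalIntegrable_const
    fun s hs => hE s (ht.trans hs.1)
  rw [intervalIntegral.integral_const, add_sub_cancel_left, one_smul] at hmono
  linarith

end Summit.AnomalousDissipation.AnomalousDissipation.Theorems.ChainRealisation.SeparatrixFluxPinning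

end
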